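import Summits.RiemannHypothesis.MotivicDoor.AWS.ForcingDown
import Summits.RiemannHypothesis.RiemannHypothesis.Theorems.MotivicDoor.AWS.SkeletonPairing

/-!
# Prime-side skeleton, part 2: the real-coefficient carrier and `(∃ X, X.gen = G) ↔ RH`

AWS sprint (cell `pub-rhdoor`, seat cc-4), the AXIOM-CONTENT audit (§2/§4 of the referees' file):
a structure satisfying ALL `ArithmeticWeilSurface` axioms EXCEPT `hodge`, from PRIME-SIDE data
alone.  HONEST LABEL: the sprint theorem `Nonempty ArithmeticWeilSurface → RH` (aws-3,
`riemannHypothesis_of_arithmeticWeilSurface`) is a one-way implication from a strengthened,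
prime-side-only axiom system; the existence of such an object is NOT claimed and is the located gap;
satisfiability of the axiom system is EQUIVALENT to RH (forward by forcing, converse tautological:
aws-2's `AWS/PrimeSideLattice`, `nonempty_arithmeticWeilSurface_iff_riemannHypothesis`, on the
INTEGER carrier `(G.ι →₀ ℤ) × ℤ × ℤ`, landed first).  THIS FILE (PROVED) is the companion on the
REAL-COEFFICIENT carrier `L = (G.ι →₀ ℝ) × ℝ × ℝ` (an `ℝ`-vector space of rank `|G.ι| + 2`: the
axioms impose no integrality and no finite-rank constraint on the carrier, AXIOM-CONTENT §2 (iii)),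
built on the real-combination calculus of `AWS/SkeletonPairing`: the decreed pairing
`G.skeletonInter`
(`(r,α,β)·(r',α',β') = B(r,r') + α' m⋆(r) + α m⋆(r') + β' m(r) + β m(r') + αβ' + α'β`,
`ℝ`-bilinear as `G.skeletonBilin`) satisfies EVERY axiom but `hodge` unconditionally
(`skeletonInter_comm`, `…_e₁_e₁`, `…_e₂_e₂`, `…_e₁_e₂`, `…_cycle_e₁`, `…_cycle_e₂`,
`…_cycle_cycle`);
`x·x = 2(x·e₁)(x·e₂) − Re Q(U_{x.1})` (`skeletonInter_self`), so the Hodge field on it is EXACTLY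
`Re Q ≥ 0` on the real span of the generators (`skeleton_hodge_iff` — both directions elementary, no
forcing, no continuity) and ⟺ RH (`skeleton_hodge_iff_riemannHypothesis`); the carrier
`G.skeletonOfHodge`, and the per-family verdicts `exists_arithmeticWeilSurface_iff :
(∃ X : ArithmeticWeilSurface, X.gen = G) ↔ RH`, `nonempty_arithmeticWeilSurface_iff :
Nonempty ArithmeticWeilSurface ↔ Nonempty GeneratingFamily ∧ RH`.
Framing: lottery ticket at the motivic door; RH probability negligible; consolation prizes are real:
a new semi-local Weil-positivity theorem, or a located gap in the Connes–Consani programme, plus the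
ff-door theorem.  Refs: Weil 1952; Bombieri 2000 Thm 2; Connes–Consani arXiv:1805.10501 §3.1.
-/

noncomputable section

open Complex Set MeasureTheory Literature.NumberTheory.LFunctions
open Literature.NumberTheory.ConnesConsani2019
open Summit.RiemannHypothesis.RiemannHypothesis.Theorems
open Summit.RiemannHypothesis.RiemannHypothesis.Theorems.MotivicDoor.ConnesConsani
open scoped ComplexConjugate

namespace Summit.RiemannHypothesis.RiemannHypothesis.Theorems.MotivicDoor.AWS

namespace GeneratingFamily

variable (G : GeneratingFamily)

/-- The skeleton pairing on `L = (G.ι →₀ ℝ) × ℝ × ℝ` as a function. -/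
def skeletonFormFun (x y : (G.ι →₀ ℝ) × ℝ × ℝ) : ℝ :=
  G.gram x.1 y.1 + (y.2.1 * G.mStar x.1 + x.2.1 * G.mStar y.1) +
    (y.2.2 * G.mU x.1 + x.2.2 * G.mU y.1) + (x.2.1 * y.2.2 + y.2.1 * x.2.2)

/-- The skeleton pairing is `ℝ`-bilinear. -/
def skeletonBilin : ((G.ι →₀ ℝ) × ℝ × ℝ) →ₗ[ℝ] ((G.ι →₀ ℝ) × ℝ × ℝ) →ₗ[ℝ] ℝ := by
  refine LinearMap.mk₂ ℝ G.skeletonFormFun ?_ ?_ ?_ ?_ <;> intros <;>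
    simp only [skeletonFormFun, Prod.fst_add, Prod.snd_add, Prod.smul_fst, Prod.smul_snd,
      smul_eq_mul, gram_add_left, gram_add_right, gram_smul_left, gram_smul_right, mStar_add,
      mU_add, mStar_smul, mU_smul] <;> ring

/-- Evaluation of the bilinear skeleton pairing. -/
theorem skeletonBilin_apply (x y : (G.ι →₀ ℝ) × ℝ × ℝ) :
    G.skeletonBilin x y = G.skeletonFormFun x y := rfl

/-- The skeleton pairing as a biadditive map (the shape of the structure field `inter`). -/
def skeletonInter : ((G.ι →₀ ℝ) × ℝ × ℝ) →+ ((G.ι →₀ ℝ) × ℝ × ℝ) →+ ℝ :=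
  LinearMap.toAddMonoidHom'.comp G.skeletonBilin.toAddMonoidHom

/-- Evaluation of the biadditive skeleton pairing. -/
theorem skeletonInter_apply (x y : (G.ι →₀ ℝ) × ℝ × ℝ) :
    G.skeletonInter x y = G.skeletonFormFun x y := rfl


/-- Axiom `inter_comm` for the skeleton. -/
theorem skeletonInter_comm (x y : (G.ι →₀ ℝ) × ℝ × ℝ) :
    G.skeletonInter x y = G.skeletonInter y x := by
  rw [skeletonInter_apply, skeletonInter_apply, skeletonFormFun, skeletonFormFun, gram_comm]
  ring

/-- Axiom `e₁·e₁ = 0` for the skeleton. -/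
theorem skeletonInter_e₁_e₁ : G.skeletonInter (0, 1, 0) (0, 1, 0) = 0 := by
  simp [skeletonInter_apply, skeletonFormFun, gram_zero_left, mStar_zero]

/-- Axiom `e₂·e₂ = 0` for the skeleton. -/
theorem skeletonInter_e₂_e₂ : G.skeletonInter (0, 0, 1) (0, 0, 1) = 0 := by
  simp [skeletonInter_apply, skeletonFormFun, gram_zero_left, mU_zero]

/-- Axiom `e₁·e₂ = 1` for the skeleton. -/
theorem skeletonInter_e₁_e₂ : G.skeletonInter (0, 1, 0) (0, 0, 1) = 1 := by
  simp [skeletonInter_apply, skeletonFormFun, gram_zero_left, mStar_zero, mU_zero]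

/-- `x·e₁ = m⋆(x.1) + β`. -/
theorem skeletonInter_e₁ (x : (G.ι →₀ ℝ) × ℝ × ℝ) :
    G.skeletonInter x (0, 1, 0) = G.mStar x.1 + x.2.2 := by
  simp [skeletonInter_apply, skeletonFormFun, gram_zero_right, mStar_zero, mU_zero]

/-- `x·e₂ = m(x.1) + α`. -/
theorem skeletonInter_e₂ (x : (G.ι →₀ ℝ) × ℝ × ℝ) :
    G.skeletonInter x (0, 0, 1) = G.mU x.1 + x.2.1 := by
  simp [skeletonInter_apply, skeletonFormFun, gram_zero_right, mStar_zero, mU_zero]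

/-- **Primitive projection on the skeleton**: `x·x = 2 (x·e₁)(x·e₂) − Re Q(U_{x.1})`. -/
theorem skeletonInter_self (x : (G.ι →₀ ℝ) × ℝ × ℝ) :
    G.skeletonInter x x =
      2 * (G.skeletonInter x (0, 1, 0) * G.skeletonInter x (0, 0, 1)) -
        (weilQuadratic (G.combC x.1)).re := by
  rw [skeletonInter_e₁, skeletonInter_e₂, skeletonInter_apply, skeletonFormFun, gram_self]
  ring

/-- The cycle of an integer combination: `Σ c_i frob i = (ĉ, 0, 0)`. -/
theorem cycle_eq (c : G.ι →₀ ℤ) :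
    (c.sum fun i n ↦ n • ((Finsupp.single i (1 : ℝ), (0 : ℝ), (0 : ℝ)) : (G.ι →₀ ℝ) × ℝ × ℝ)) =
      (c.sum fun i n ↦ Finsupp.single i (n : ℝ), 0, 0) := by
  simp only [Finsupp.sum]
  refine Prod.ext ?_ (Prod.ext ?_ ?_)
  · rw [Prod.fst_sum]
    refine Finset.sum_congr rfl fun i _ ↦ ?_
    rw [Prod.smul_fst, Finsupp.smul_single, Int.smul_one_eq_cast]
  · rw [Prod.snd_sum, Prod.fst_sum]
    simp
  · rw [Prod.snd_sum, Prod.snd_sum]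
    simp

/-- Prime-side axiom `D(u_c)·e₁ = ∫ f_c d*u` for the skeleton. -/
theorem skeletonInter_cycle_e₁ (c : G.ι →₀ ℤ) :
    G.skeletonInter (c.sum fun i n ↦ n • ((Finsupp.single i (1 : ℝ), (0 : ℝ), (0 : ℝ)) :
      (G.ι →₀ ℝ) × ℝ × ℝ)) (0, 1, 0) = massDstar (toMul (testCombination G.φ c)) := by
  rw [cycle_eq, skeletonInter_e₁, mStar, linearCombination_intComb]
  simp

/-- Prime-side axiom `D(u_c)·e₂ = ∫ f_c du` for the skeleton. -/
theorem skeletonInter_cycle_e₂ (c : G.ι →₀ ℤ) :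
    G.skeletonInter (c.sum fun i n ↦ n • ((Finsupp.single i (1 : ℝ), (0 : ℝ), (0 : ℝ)) :
      (G.ι →₀ ℝ) × ℝ × ℝ)) (0, 0, 1) = massDu (toMul (testCombination G.φ c)) := by
  rw [cycle_eq, skeletonInter_e₂, mU, linearCombination_intComb]
  simp

/-- Prime-side axiom `D(u_c)·D(u_c) = 2𝔰(f_c, f_c)` for the skeleton (by
`two_mul_ccPairing_toMul_eq_masses_sub`). -/
theorem skeletonInter_cycle_cycle (c : G.ι →₀ ℤ) :
    G.skeletonInter
        (c.sum fun i n ↦ n • ((Finsupp.single i (1 : ℝ), (0 : ℝ), (0 : ℝ)) : (G.ι →₀ ℝ) × ℝ × ℝ))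
        (c.sum fun i n ↦ n • ((Finsupp.single i (1 : ℝ), (0 : ℝ), (0 : ℝ)) : (G.ι →₀ ℝ) × ℝ × ℝ)) =
      2 * ccPairing (toMul (testCombination G.φ c)) (toMul (testCombination G.φ c)) := by
  rw [cycle_eq, skeletonInter_self, skeletonInter_e₁, skeletonInter_e₂, combC_intComb, mStar, mU,
    linearCombination_intComb,
    two_mul_ccPairing_toMul_eq_masses_sub (G.isWeilTest_coe_testCombination c)]
  simp


/-- Linearity in the first slot along a real combination of lattice vectors. -/
theorem sum_mul_skeletonInter {n : ℕ} (v : Fin n → (G.ι →₀ ℝ) × ℝ × ℝ) (a : Fin n → ℝ)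
    (w : (G.ι →₀ ℝ) × ℝ × ℝ) :
    ∑ k, a k * G.skeletonInter (v k) w = G.skeletonInter (∑ k, a k • v k) w := by
  change ∑ k, a k * G.skeletonBilin (v k) w = G.skeletonBilin (∑ k, a k • v k) w
  rw [map_sum, LinearMap.sum_apply]
  simp only [map_smul, LinearMap.smul_apply, smul_eq_mul]

/-- Bilinearity along a real combination: `Σ_k Σ_l a_k a_l v_k·v_l = x·x`, `x = Σ a_k v_k`. -/
theorem sum_sum_mul_skeletonInter {n : ℕ} (v : Fin n → (G.ι →₀ ℝ) × ℝ × ℝ) (a : Fin n → ℝ) :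
    ∑ k, ∑ l, a k * a l * G.skeletonInter (v k) (v l) =
      G.skeletonInter (∑ k, a k • v k) (∑ k, a k • v k) := by
  rw [← sum_mul_skeletonInter]
  refine Finset.sum_congr rfl fun k _ ↦ ?_
  change _ = a k * G.skeletonBilin (v k) (∑ l, a l • v l)
  rw [map_sum, Finset.mul_sum]
  refine Finset.sum_congr rfl fun l _ ↦ ?_
  simp only [map_smul, smul_eq_mul, skeletonBilin_apply, skeletonInter_apply]
  ring

/-- **The Hodge field on the skeleton ⟺ `Re Q ≥ 0` on the real span of the generators.** -/
theorem skeleton_hodge_iff :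
    (∀ (n : ℕ) (v : Fin n → (G.ι →₀ ℝ) × ℝ × ℝ) (a : Fin n → ℝ),
        (∑ k, a k * G.skeletonInter (v k) (0, 1, 0) = 0) →
          (∑ k, a k * G.skeletonInter (v k) (0, 0, 1) = 0) →
            ∑ k, ∑ l, a k * a l * G.skeletonInter (v k) (v l) ≤ 0) ↔
      ∀ r : G.ι →₀ ℝ, 0 ≤ (weilQuadratic (G.combC r)).re := by
  constructor
  · intro h r
    have H := h 1 ![(r, -G.mU r, -G.mStar r)] ![1]
      (by simp [skeletonInter_e₁]) (by simp [skeletonInter_e₂])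
    simp only [Fin.sum_univ_one, Matrix.cons_val_zero, one_mul, skeletonInter_self,
      skeletonInter_e₁, skeletonInter_e₂] at H
    linarith
  · intro hpos n v a h₁ h₂
    rw [sum_mul_skeletonInter] at h₁ h₂
    rw [sum_sum_mul_skeletonInter, skeletonInter_self, h₁, h₂]
    have := hpos (∑ k, a k • v k).1
    linarith

/-- **The prime-side skeleton is an arithmetic Weil surface as soon as `Re Q ≥ 0` on the real span
of the generators** (the Hodge field is then `skeleton_hodge_iff`). -/
def skeletonOfHodge (hpos : ∀ r : G.ι →₀ ℝ, 0 ≤ (weilQuadratic (G.combC r)).re) :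
    ArithmeticWeilSurface where
  gen := G
  L := (G.ι →₀ ℝ) × ℝ × ℝ
  inter := G.skeletonInter
  inter_comm := G.skeletonInter_comm
  e₁ := (0, 1, 0)
  e₂ := (0, 0, 1)
  inter_e₁_e₁ := G.skeletonInter_e₁_e₁
  inter_e₂_e₂ := G.skeletonInter_e₂_e₂
  inter_e₁_e₂ := G.skeletonInter_e₁_e₂
  frob := fun i ↦ (Finsupp.single i 1, 0, 0)
  frob_e₁ := G.skeletonInter_cycle_e₁
  frob_e₂ := G.skeletonInter_cycle_e₂
  frob_frob := G.skeletonInter_cycle_cycle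
  hodge := G.skeleton_hodge_iff.2 hpos

/-- **The Hodge field on the skeleton ⟺ RH.** (`→`: the skeleton is then an arithmetic Weil surface,
so `riemannHypothesis_of_arithmeticWeilSurface` applies; `←`: Weil's criterion gives `Re Q ≥ 0` on
the real span.) -/
theorem skeleton_hodge_iff_riemannHypothesis :
    (∀ (n : ℕ) (v : Fin n → (G.ι →₀ ℝ) × ℝ × ℝ) (a : Fin n → ℝ),
        (∑ k, a k * G.skeletonInter (v k) (0, 1, 0) = 0) →
          (∑ k, a k * G.skeletonInter (v k) (0, 0, 1) = 0) →
            ∑ k, ∑ l, a k * a l * G.skeletonInter (v k) (v l) ≤ 0) ↔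
      _root_.RiemannHypothesis := by
  rw [skeleton_hodge_iff]
  refine ⟨fun h ↦ riemannHypothesis_of_arithmeticWeilSurface ⟨G.skeletonOfHodge h⟩, fun hRH ↦ ?_⟩
  exact fun r ↦ (show _root_.RiemannHypothesis ↔ WeilPositivity from weil_criterion_holds).1 hRH _
    (G.isWeilTest_combC r)

end GeneratingFamily


/-- **`(∃ X : ArithmeticWeilSurface, X.gen = G) ↔ RH`** for every generating family `G`. -/
theorem exists_arithmeticWeilSurface_iff (G : GeneratingFamily) :
    (∃ X : ArithmeticWeilSurface, X.gen = G) ↔ _root_.RiemannHypothesis := by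
  refine ⟨fun ⟨X, _⟩ ↦ riemannHypothesis_of_arithmeticWeilSurface ⟨X⟩, fun hRH ↦ ?_⟩
  exact ⟨G.skeletonOfHodge (G.skeleton_hodge_iff.1 (G.skeleton_hodge_iff_riemannHypothesis.2 hRH)),
    rfl⟩

/-- **VERDICT THEOREM.**  `Nonempty ArithmeticWeilSurface ↔ Nonempty GeneratingFamily ∧ RH`: the
strengthened, prime-side-only axiom system is satisfiable iff RH holds (and a `C¹`-dense family of
real test functions exists — pure analysis, no arithmetic).  Forward: aws-3's
`riemannHypothesis_of_arithmeticWeilSurface`; backward: the prime-side skeleton. -/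
theorem nonempty_arithmeticWeilSurface_iff :
    Nonempty ArithmeticWeilSurface ↔ Nonempty GeneratingFamily ∧ _root_.RiemannHypothesis := by
  refine ⟨fun ⟨X⟩ ↦ ⟨⟨X.gen⟩, riemannHypothesis_of_arithmeticWeilSurface ⟨X⟩⟩, fun ⟨⟨G⟩, hRH⟩ ↦ ?_⟩
  obtain ⟨X, -⟩ := (exists_arithmeticWeilSurface_iff G).2 hRH
  exact ⟨X⟩

end Summit.RiemannHypothesis.RiemannHypothesis.Theorems.MotivicDoor.AWS

end
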